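import Summits.BirchSwinnertonDyer.BirchSwinnertonDyer.Theorems.TwoAdicConverseEulerFactorAtTwo
import HarnessLib

/-!
# (K) kernel principle for line `cfsplit` / stub (A′) `stub_depletedLawCF` (crux E1M, item stmt-BirchSwinnertonDyer-20341,
# route `EisensteinDepletionAtTwo`): `μ(F) = μ(G) = 0 ∧ F ≡ G (mod pΛ) ⟹ λ(F) = λ(G)`

Cell `bsd-rank2` (HOME run/shared/lean/pub/bsd-rank2/), seat `bsd-rank2-eng-2` GEN 5 — landing VERBATIM (namespace moved from the
planner's `Cruxes.…CfSplit` scratch to `Theorems.DepletionAtTwo`) planner p2 GEN 17's scratch `HOME/p2/g17/KernelPrinciple.lean`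
(STATUS 2026-08-27T12:23:54Z (1): «land the (K) kernel principle verbatim … --supports stmt-BirchSwinnertonDyer-20341»).
The step that turns an Eisenstein congruence of `2`-adic Mazur–Tate / `L`-elements modulo `2Λ` into an equality of
`λ`-invariants once both sides have unit content (Greenberg–Vatsal 2000 §1 (1)–(2); Washington §7.1). Everything used is
already in the tree: `GreenbergVatsal2000.HasUnitContent`, `X2.GreenbergVatsalAnalyticTransferCore.natCast_lam_eq_order_map_toZMod`,
`X1.MuLambda.{lam_mul, mu_mul, isUnit_iff_mu_eq_zero_and_lam_eq_zero}`, `TwoAdicTwistConverse.hasUnitContent_iff_mu_eq_zero`.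

THEOREMS ONLY (no definition, no named fact, no `sorry`). PARTITION: none — r_an ≥ 2, summit axis S0 (D-0036(1)); TWIN (D-0056):
n/a. B1 honesty: pure `Λ`-algebra; nothing reads an analytic rank; no S0 motion.

References: R. Greenberg, V. Vatsal, Invent. Math. 142 (2000), §1 (1)–(2) [GreenbergVatsal2000]; L. Washington, GTM 83, §7.1
[Washington1997].
-/

set_option linter.dupNamespace false
set_option autoImplicit false

noncomputable section

open scoped Classical

open Literature.NumberTheory.EllipticCurves Literature.NumberTheory.EllipticCurves.GreenbergVatsal2000
  Summit.BirchSwinnertonDyer.Rank1Residual.X1.MuLambda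
  Summit.BirchSwinnertonDyer.Rank1Residual.X2.GreenbergVatsalAnalyticTransferCore
  Summit.BirchSwinnertonDyer.BirchSwinnertonDyer.Theorems.TwoAdicTwistConverse

namespace Summit.BirchSwinnertonDyer.BirchSwinnertonDyer.Theorems.DepletionAtTwo

variable {p : ℕ} [Fact p.Prime]

/-- Congruent elements of `Λ = ℤ_p⟦T⟧` have the same reduction mod `p`. [cite: Washington1997, §7.1] -/
theorem map_toZMod_eq_of_C_dvd_sub {F G : IwasawaAlgebra p} (h : PowerSeries.C (p : ℤ_[p]) ∣ F - G) :
    PowerSeries.map (PadicInt.toZMod (p := p)) F = PowerSeries.map (PadicInt.toZMod (p := p)) G := by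
  obtain ⟨q, hq⟩ := h
  have h0 : PowerSeries.map (PadicInt.toZMod (p := p)) (F - G) = 0 := by
    rw [hq, map_mul, PowerSeries.map_C]
    have : (PadicInt.toZMod (p := p)) (p : ℤ_[p]) = 0 := by
      rw [map_natCast, ZMod.natCast_self]
    rw [this, map_zero, zero_mul]
  rwa [map_sub, sub_eq_zero] at h0

/-- **(K) kernel principle.** If `F, G ∈ Λ = ℤ_p⟦T⟧` both have unit content (`μ = 0`) and `F ≡ G (mod pΛ)`, then
`λ(F) = λ(G)` (`λ` = the cell's `X1.MuLambda.lam`). [cite: GreenbergVatsal2000, §1 (1)–(2)] [cite: Washington1997, §7.1] -/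
theorem lam_eq_of_hasUnitContent_of_C_dvd_sub {F G : IwasawaAlgebra p} (hF : HasUnitContent F)
    (hG : HasUnitContent G) (h : PowerSeries.C (p : ℤ_[p]) ∣ F - G) : lam F = lam G := by
  have hF' := natCast_lam_eq_order_map_toZMod hF
  have hG' := natCast_lam_eq_order_map_toZMod hG
  rw [map_toZMod_eq_of_C_dvd_sub h] at hF'
  exact_mod_cast hF'.trans hG'.symm

/-- (K) with a unit multiplier, the shape an Eisenstein congruence actually delivers:
`F ≡ u·G (mod pΛ)` with `u ∈ Λˣ` and both of unit content ⟹ `λ(F) = λ(G)`. [cite: GreenbergVatsal2000, §1 (1)–(2) and §3 (the unit in Thm. (3.11))] -/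
theorem lam_eq_of_hasUnitContent_of_C_dvd_sub_units_mul {F G : IwasawaAlgebra p} (u : (IwasawaAlgebra p)ˣ)
    (hF : HasUnitContent F) (hG : HasUnitContent G) (hG0 : G ≠ 0)
    (h : PowerSeries.C (p : ℤ_[p]) ∣ F - u * G) : lam F = lam G := by
  have hu0 : (u : IwasawaAlgebra p) ≠ 0 := u.ne_zero
  obtain ⟨-, hmu, hlam⟩ := (isUnit_iff_mu_eq_zero_and_lam_eq_zero (u : IwasawaAlgebra p)).mp u.isUnit
  have huG : HasUnitContent ((u : IwasawaAlgebra p) * G) := by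
    rw [hasUnitContent_iff_mu_eq_zero (mul_ne_zero hu0 hG0), mu_mul hu0 hG0, hmu, zero_add,
      ← hasUnitContent_iff_mu_eq_zero hG0]
    exact hG
  rw [lam_eq_of_hasUnitContent_of_C_dvd_sub hF huG h, lam_mul hu0 hG0, hlam, zero_add]

end Summit.BirchSwinnertonDyer.BirchSwinnertonDyer.Theorems.DepletionAtTwo

end
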